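import Summits.CriticalPhenomena.PercolationContinuityZ3.Theorems.Transplant.SkelNegBParamsRootLam
import Summits.CriticalPhenomena.PercolationContinuityZ3.Theorems.Transplant.SkelNegBParamsReachTA
import HarnessLib

/-!
# N1 params, chain of record `NegB`, part RootLam-A — the (ζ′) twin of part RootLam §1–§3's cell-reading parts at `A := Aof κ = 20·K`: the fine ceilings of the near-root
# footprints **`KS.kR₀A := ⌈c₀·|A|·ΛR₀/D_A⌉`**, **`KS.kR₁A := ⌈c₁·|A|·ΛR₁/D_A⌉`** over the (ζ′) record `prFA` (the functionals `ΛR₀/ΛR₁`, the collar `eR`, `prB`, the region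
# lemmas `hΛR_R/hΛQ_R/ΛR_le/five_eR_le_ML` are part RootLam's — cell-free, reused), with **`hkR0_RA/hkR1_RA`**, the sizes **`kRA_le : kR_iA ≤ 8·s_i + 1`** (`c_i·A/D_A = s_i/m`:
# NO `Kq` — one stride is `s_i` cells) and the footprint floors **`hfR_RA`** (`kR₀A ≤ 25r₀ − 1`, `kR₁A ≤ 5r₁ − 2`, … with `r_i = K·s_i = 40Kq·s_i`: margins `Kq`× wider than today's)
# (stmt-g16 2026-08-22; NEG-SCOPE §B.19 (ζ′))
builds on p205010 (kernel theorem, internal audit signed; external expert review pending) — nothing in this file uses p205010; NOTHING is claimed about the node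
`SamePDropOfSkeletonNeg₁` (OPEN).
Lane `prim-bschramm-*`, seat `prim-bschramm-stmt` (gen 16); helper file (`--supports stmt-CriticalPhenomena-4575 --as helper`); ledger HOME/prim-bschramm-stmt/NEG-PARAMS.md.
* §1 **`KS.kR₀A/kR₁A`**, `kRA_pos`, **`hkR0_RA/hkR1_RA`**; §2 **`kRA_le`**, **`hfR_RA`**.
[cite: KozmaNitzan2024, §4 p. 28 ((32) at the root), Lemma 10 Step IV] [cite: MartineauTassion2017, §3.2, §4.3]
-/

noncomputable section

open scoped Classical

namespace Summit.CriticalPhenomena.PercolationContinuityZ3.Theorems.Transplant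

namespace PlanarSkeletonNeg

namespace NegB

namespace KS

open Literature.Probability.Percolation Literature.Probability.LatticeModels SimpleGraph
open SkelConc (Consts)
open Skelφ.StepI (DataN)
open TwoAxis.Para (modulus)
open Neg

/-! ## §1 The fine ceilings over the (ζ′) record -/

section Values

variable (κ : Consts) {V : Type} [DecidableEq V] [Countable V] {G : SimpleGraph V} [G.LocallyFinite] (Φ : PlanarSkeletonNeg G) (t : V)
  (p : unitInterval) (D : DataN V) (g f mk : ℕ)

/-- **`kR₀A := ⌈c₀·|A|·ΛR₀ / D_A⌉`** (floor + 1) over `prFA`. [this work] -/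
def kR₀A : ℤ := (prFA κ Φ t p D g f).c₀ * (|(prFA κ Φ t p D g f).A| * ΛR₀ κ Φ t p D g f mk) / (prFA κ Φ t p D g f).D + 1

/-- **`kR₁A := ⌈c₁·|A|·ΛR₁ / D_A⌉`** (floor + 1) over `prFA`. [this work] -/
def kR₁A : ℤ := (prFA κ Φ t p D g f).c₁ * (|(prFA κ Φ t p D g f).A| * ΛR₁ κ Φ t p D g f mk) / (prFA κ Φ t p D g f).D + 1

/-- `1 ≤ kR₀A`, `1 ≤ kR₁A` (the quotients are nonnegative). [folklore] -/
theorem kRA_pos (hN : EqNumL κ Φ t p D g f) : 1 ≤ kR₀A κ Φ t p D g f mk ∧ 1 ≤ kR₁A κ Φ t p D g f mk := by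
  obtain ⟨hΛp0, hΛp1⟩ := ΛR_nonneg κ Φ t p D g f mk hN
  obtain ⟨hA, -, -, hc₀, hc₁, hD⟩ := prFA_pos κ Φ t p D g f hN
  have hAabs : 0 ≤ |(prFA κ Φ t p D g f).A| := abs_nonneg _
  constructor
  · unfold kR₀A
    have : 0 ≤ (prFA κ Φ t p D g f).c₀ * (|(prFA κ Φ t p D g f).A| * ΛR₀ κ Φ t p D g f mk) / (prFA κ Φ t p D g f).D :=
      Int.ediv_nonneg (mul_nonneg hc₀.le (mul_nonneg hAabs hΛp0)) hD.le
    linarith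
  · unfold kR₁A
    have : 0 ≤ (prFA κ Φ t p D g f).c₁ * (|(prFA κ Φ t p D g f).A| * ΛR₁ κ Φ t p D g f mk) / (prFA κ Φ t p D g f).D :=
      Int.ediv_nonneg (mul_nonneg hc₁.le (mul_nonneg hAabs hΛp1)) hD.le
    linarith

/-- **`hkR0` of the (ζ′) chain**: `20K s₀·(|A|·ΛR₀) ≤ kR₀A·D_A`. [folklore] -/
theorem hkR0_RA (hN : EqNumL κ Φ t p D g f) :
    20 * ((fcellsA κ Φ t p D g f).K : ℤ) * (((fcellsA κ Φ t p D g f).s 0 : ℕ) : ℤ) * (|Aof κ| * ΛR₀ κ Φ t p D g f mk) ≤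
      kR₀A κ Φ t p D g f mk * Skelφ.NegPrm.DofA (Aof κ) (nL κ Φ t p D g f) (hL κ Φ t p D g f) (ℓL κ Φ t p D g f) (vL κ Φ t p D g f) := by
  have hD := (prFA_pos κ Φ t p D g f hN).2.2.2.2.2
  show (prFA κ Φ t p D g f).c₀ * (|(prFA κ Φ t p D g f).A| * ΛR₀ κ Φ t p D g f mk) ≤ kR₀A κ Φ t p D g f mk * (prFA κ Φ t p D g f).D
  unfold kR₀A
  rw [mul_comm (_ / _ + 1)]
  exact ceil_mul_le hD

/-- **`hkR1` of the (ζ′) chain**: `20K s₁·(|A|·ΛR₁) ≤ kR₁A·D_A`. [folklore] -/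
theorem hkR1_RA (hN : EqNumL κ Φ t p D g f) :
    20 * ((fcellsA κ Φ t p D g f).K : ℤ) * (((fcellsA κ Φ t p D g f).s 1 : ℕ) : ℤ) * (|Aof κ| * ΛR₁ κ Φ t p D g f mk) ≤
      kR₁A κ Φ t p D g f mk * Skelφ.NegPrm.DofA (Aof κ) (nL κ Φ t p D g f) (hL κ Φ t p D g f) (ℓL κ Φ t p D g f) (vL κ Φ t p D g f) := by
  have hD := (prFA_pos κ Φ t p D g f hN).2.2.2.2.2
  show (prFA κ Φ t p D g f).c₁ * (|(prFA κ Φ t p D g f).A| * ΛR₁ κ Φ t p D g f mk) ≤ kR₁A κ Φ t p D g f mk * (prFA κ Φ t p D g f).D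
  unfold kR₁A
  rw [mul_comm (_ / _ + 1)]
  exact ceil_mul_le hD

end Values

/-! ## §2 The sizes at `g := gT` -/

section AtT

variable (κ : Consts) {V : Type} [DecidableEq V] [Countable V] {G : SimpleGraph V} [G.LocallyFinite] (Φ : PlanarSkeletonNeg G) (t : V)
  (p : unitInterval) (D : DataN V) (mk : ℕ) (gx : Neg.FSlot) (f : ℕ)

/-- **`kR₀A ≤ 8·s₀ + 1`, `kR₁A ≤ 8·s₁ + 1`** at `g := gT` (`c_i·A/D_A = s_i/m` — NO `Kq`: one stride is `s_i` cells). [folklore] -/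
theorem kRA_le (hN : EqNumL κ Φ t p D (gT mk gx κ Φ t p D) f) (hκ : (hL κ Φ t p D (gT mk gx κ Φ t p D) f).natAbs ≤ 10 * nL κ Φ t p D (gT mk gx κ Φ t p D) f) :
    kR₀A κ Φ t p D (gT mk gx κ Φ t p D) f mk ≤ 8 * (((fcellsA κ Φ t p D (gT mk gx κ Φ t p D) f).s 0 : ℕ) : ℤ) + 1 ∧
      kR₁A κ Φ t p D (gT mk gx κ Φ t p D) f mk ≤ 8 * (((fcellsA κ Φ t p D (gT mk gx κ Φ t p D) f).s 1 : ℕ) : ℤ) + 1 := by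
  obtain ⟨hn1, hℓ1⟩ := one_le_of_eqNumL κ Φ t p D _ f hN
  obtain ⟨hΛ0, hΛ1⟩ := ΛR_le κ Φ t p D mk gx f hN hκ
  have hm : 0 < modulus (nL κ Φ t p D (gT mk gx κ Φ t p D) f) (hL κ Φ t p D (gT mk gx κ Φ t p D) f) (vL κ Φ t p D (gT mk gx κ Φ t p D) f)
      (vβL κ Φ t p D (gT mk gx κ Φ t p D) f) := Skelφ.NegPrm.modulus_vβOf_pos hn1 hℓ1 _ _
  have hK : ((fcellsA κ Φ t p D (gT mk gx κ Φ t p D) f).K : ℤ) = Neg.K κ := by rw [(fcellsA_K κ Φ t p D _ f).1]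
  have hA : 0 < Aof κ := (Aof_pos κ).1
  have hA2 : (0 : ℤ) < (Aof κ) ^ 2 := pow_pos hA 2
  have key : ∀ (s : ℕ) (Λ : ℤ), Λ ≤ 8 * modulus (nL κ Φ t p D (gT mk gx κ Φ t p D) f) (hL κ Φ t p D (gT mk gx κ Φ t p D) f) (vL κ Φ t p D (gT mk gx κ Φ t p D) f)
      (vβL κ Φ t p D (gT mk gx κ Φ t p D) f) →
      20 * ((fcellsA κ Φ t p D (gT mk gx κ Φ t p D) f).K : ℤ) * ((s : ℕ) : ℤ) * (|Aof κ| * Λ) /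
          Skelφ.NegPrm.DofA (Aof κ) (nL κ Φ t p D (gT mk gx κ Φ t p D) f) (hL κ Φ t p D (gT mk gx κ Φ t p D) f) (ℓL κ Φ t p D (gT mk gx κ Φ t p D) f)
            (vL κ Φ t p D (gT mk gx κ Φ t p D) f) ≤ 8 * ((s : ℕ) : ℤ) := by
    intro s Λ hΛ
    rw [Skelφ.NegPrm.DofA_eq, hK, abs_of_pos hA]
    have e1 : 20 * (Neg.K κ : ℤ) * ((s : ℕ) : ℤ) * (Aof κ * Λ) = (Aof κ) ^ 2 * (((s : ℕ) : ℤ) * Λ) := by rw [Aof_eq_K]; ring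
    rw [e1]
    show (Aof κ) ^ 2 * (((s : ℕ) : ℤ) * Λ) / ((Aof κ) ^ 2 * modulus (nL κ Φ t p D (gT mk gx κ Φ t p D) f) (hL κ Φ t p D (gT mk gx κ Φ t p D) f)
      (vL κ Φ t p D (gT mk gx κ Φ t p D) f) (Skelφ.NegPrm.vβOf (nL κ Φ t p D (gT mk gx κ Φ t p D) f) (hL κ Φ t p D (gT mk gx κ Φ t p D) f)
        (ℓL κ Φ t p D (gT mk gx κ Φ t p D) f) (vL κ Φ t p D (gT mk gx κ Φ t p D) f))) ≤ _
    rw [Int.mul_ediv_mul_of_pos _ _ hA2,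
      show Skelφ.NegPrm.vβOf (nL κ Φ t p D (gT mk gx κ Φ t p D) f) (hL κ Φ t p D (gT mk gx κ Φ t p D) f) (ℓL κ Φ t p D (gT mk gx κ Φ t p D) f)
        (vL κ Φ t p D (gT mk gx κ Φ t p D) f) = vβL κ Φ t p D (gT mk gx κ Φ t p D) f from rfl]
    refine Int.ediv_le_of_le_mul hm ?_
    have hs : (0 : ℤ) ≤ ((s : ℕ) : ℤ) := Nat.cast_nonneg _
    have := mul_le_mul_of_nonneg_left hΛ hs
    linarith
  constructor
  · have h := key ((fcellsA κ Φ t p D (gT mk gx κ Φ t p D) f).s 0) _ hΛ0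
    show 20 * ((fcellsA κ Φ t p D (gT mk gx κ Φ t p D) f).K : ℤ) * (((fcellsA κ Φ t p D (gT mk gx κ Φ t p D) f).s 0 : ℕ) : ℤ) *
        (|Aof κ| * ΛR₀ κ Φ t p D (gT mk gx κ Φ t p D) f mk) /
          Skelφ.NegPrm.DofA (Aof κ) (nL κ Φ t p D (gT mk gx κ Φ t p D) f) (hL κ Φ t p D (gT mk gx κ Φ t p D) f) (ℓL κ Φ t p D (gT mk gx κ Φ t p D) f)
            (vL κ Φ t p D (gT mk gx κ Φ t p D) f) + 1 ≤ _
    linarith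
  · have h := key ((fcellsA κ Φ t p D (gT mk gx κ Φ t p D) f).s 1) _ hΛ1
    show 20 * ((fcellsA κ Φ t p D (gT mk gx κ Φ t p D) f).K : ℤ) * (((fcellsA κ Φ t p D (gT mk gx κ Φ t p D) f).s 1 : ℕ) : ℤ) *
        (|Aof κ| * ΛR₁ κ Φ t p D (gT mk gx κ Φ t p D) f mk) /
          Skelφ.NegPrm.DofA (Aof κ) (nL κ Φ t p D (gT mk gx κ Φ t p D) f) (hL κ Φ t p D (gT mk gx κ Φ t p D) f) (ℓL κ Φ t p D (gT mk gx κ Φ t p D) f)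
            (vL κ Φ t p D (gT mk gx κ Φ t p D) f) + 1 ≤ _
    linarith

/-- **`hfR0/hfR1` of the (ζ′) chain** at `g := gT`: `−5r₀+1 ≤ −kR₀A`, `kR₀A ≤ 25r₀ − 1`, `kR₁A ≤ 5r₁ − 2` and `−5r₁+1 ≤ −kR₁A`, `kR₁A ≤ 25r₁ − 1`, `kR₀A ≤ 5r₀ − 2`
(from `kR_iA ≤ 8 s_i + 1`, `1 ≤ kR_iA` and `r_i = K·s_i`, `K ≥ 40`). [folklore] -/
theorem hfR_RA (hN : EqNumL κ Φ t p D (gT mk gx κ Φ t p D) f) (hκ : (hL κ Φ t p D (gT mk gx κ Φ t p D) f).natAbs ≤ 10 * nL κ Φ t p D (gT mk gx κ Φ t p D) f) :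
    (-(5 * ((fcellsA κ Φ t p D (gT mk gx κ Φ t p D) f).r 0 : ℤ)) + 1 ≤ -kR₀A κ Φ t p D (gT mk gx κ Φ t p D) f mk ∧
        kR₀A κ Φ t p D (gT mk gx κ Φ t p D) f mk ≤ 25 * ((fcellsA κ Φ t p D (gT mk gx κ Φ t p D) f).r 0 : ℤ) - 1 ∧
        kR₁A κ Φ t p D (gT mk gx κ Φ t p D) f mk ≤ 5 * ((fcellsA κ Φ t p D (gT mk gx κ Φ t p D) f).r 1 : ℤ) - 2) ∧
      (-(5 * ((fcellsA κ Φ t p D (gT mk gx κ Φ t p D) f).r 1 : ℤ)) + 1 ≤ -kR₁A κ Φ t p D (gT mk gx κ Φ t p D) f mk ∧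
        kR₁A κ Φ t p D (gT mk gx κ Φ t p D) f mk ≤ 25 * ((fcellsA κ Φ t p D (gT mk gx κ Φ t p D) f).r 1 : ℤ) - 1 ∧
        kR₀A κ Φ t p D (gT mk gx κ Φ t p D) f mk ≤ 5 * ((fcellsA κ Φ t p D (gT mk gx κ Φ t p D) f).r 0 : ℤ) - 2) := by
  obtain ⟨h0, h1⟩ := kRA_le κ Φ t p D mk gx f hN hκ
  obtain ⟨hk0, hk1⟩ := kRA_pos κ Φ t p D (gT mk gx κ Φ t p D) f mk hN
  have hr := (fcellsA_K κ Φ t p D (gT mk gx κ Φ t p D) f).2.2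
  have hr0 : ((fcellsA κ Φ t p D (gT mk gx κ Φ t p D) f).r 0 : ℤ) = (Neg.K κ : ℤ) * (((fcellsA κ Φ t p D (gT mk gx κ Φ t p D) f).s 0 : ℕ) : ℤ) := by
    rw [hr 0]; push_cast; ring
  have hr1 : ((fcellsA κ Φ t p D (gT mk gx κ Φ t p D) f).r 1 : ℤ) = (Neg.K κ : ℤ) * (((fcellsA κ Φ t p D (gT mk gx κ Φ t p D) f).s 1 : ℕ) : ℤ) := by
    rw [hr 1]; push_cast; ring
  have hK : (40 : ℤ) ≤ Neg.K κ := by exact_mod_cast (Neg.forty_le_K κ).1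
  have hs0 : (1 : ℤ) ≤ (((fcellsA κ Φ t p D (gT mk gx κ Φ t p D) f).s 0 : ℕ) : ℤ) := by exact_mod_cast (fcellsA κ Φ t p D (gT mk gx κ Φ t p D) f).hs 0
  have hs1 : (1 : ℤ) ≤ (((fcellsA κ Φ t p D (gT mk gx κ Φ t p D) f).s 1 : ℕ) : ℤ) := by exact_mod_cast (fcellsA κ Φ t p D (gT mk gx κ Φ t p D) f).hs 1
  have hKs0 : 40 * (((fcellsA κ Φ t p D (gT mk gx κ Φ t p D) f).s 0 : ℕ) : ℤ) ≤ (Neg.K κ : ℤ) * (((fcellsA κ Φ t p D (gT mk gx κ Φ t p D) f).s 0 : ℕ) : ℤ) :=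
    mul_le_mul_of_nonneg_right hK (by linarith)
  have hKs1 : 40 * (((fcellsA κ Φ t p D (gT mk gx κ Φ t p D) f).s 1 : ℕ) : ℤ) ≤ (Neg.K κ : ℤ) * (((fcellsA κ Φ t p D (gT mk gx κ Φ t p D) f).s 1 : ℕ) : ℤ) :=
    mul_le_mul_of_nonneg_right hK (by linarith)
  rw [hr0, hr1]
  refine ⟨⟨by linarith, by linarith, by linarith⟩, ⟨by linarith, by linarith, by linarith⟩⟩

end AtT

end KS

end NegB

end PlanarSkeletonNeg

end Summit.CriticalPhenomena.PercolationContinuityZ3.Theorems.Transplant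

end
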